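import Mathlib
import Literature.MathematicalPhysics.QuantumLattice.RandomField
import Literature.Analysis.FunctionSpaces.MinlosBorelProofs
import Literature.Analysis.FunctionSpaces.SchwartzFunctionalSubsequenceLimit
import HarnessLib

/-!
# `FieldConfig E = 𝓢'(E)` is a standard Borel space

Topic `MathematicalPhysics/QuantumLattice` (random fields, file `RandomField`): THEOREM-ONLY support
file (requested by the route `CriticalPhenomena/Ising3DConformalLimit/BallSpecification`, crux
`BallSpecifiedFieldLimit`, whose kernel-version lemma needs regular conditional probabilities on
`𝓢'(ℝ³)`; `GermMarkov.lean` records the instance as "far from the library").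

For a finite-dimensional real normed space `E`, the space of field configurations
`FieldConfig E = 𝓢(E, ℝ) →Lₚₜ[ℝ] ℝ` (weak-* dual of the Schwartz space, Borel σ-algebra of the weak-*
topology, `Literature/MathematicalPhysics/QuantumLattice/RandomField`) is a STANDARD BOREL SPACE, so that
Mathlib's regular conditional probabilities (`ProbabilityTheory.condExpKernel`) are available on it.

Proof: `𝓢(E, ℝ)` is separable (`separableSpace_schwartzMap_holds`, tree) and first countable, so the Borel
σ-algebra of the weak-* dual is generated by the evaluations
(`borel_eq_dualCylinderSigma_of_separableSpace`, tree), indeed by the evaluations at a dense sequence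
`u`; the evaluation map `e : ω ↦ (ω (u n))ₙ` into the Polish space `ℕ → ℝ` is then injective with
`comap e = Borel`, and its range is the countable union of the continuous images of the weak-* compact
polars `{ω | ∀ f, |ω f| ≤ C · (s.sup p) f}` (closed subsets of products of compact intervals), hence
Borel; a measurable subset of a Polish space is standard Borel and the structure transfers along the
measurable equivalence `e`.

Contents: `measurableSpace_fieldConfig_eq_iSup` (Borel = σ(evaluations)), `measurable_fieldConfig_iff`
(measurability into `FieldConfig E` is checked on evaluations), `comap_eval_le_evalSigma_of_mem_closure`
(evaluations at the closure of a sequence are measurable for the σ-algebra of the sequence),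
`isCompact_polar` (weak-* compactness of polars), `measurableEmbedding_evalSeq`,
`standardBorelSpace_fieldConfig` (a theorem; use `haveI`).

References: X. Fernique, *Processus linéaires, processus généralisés*, Ann. Inst. Fourier 17 (1967),
Ch. III (duals of separable Fréchet spaces are Lusin); L. Schwartz, *Radon measures on arbitrary
topological spaces* (1973), Part I Ch. II (Lusin and Souslin spaces, standard Borel structure).
Mathlib: `StandardBorelSpace`, `MeasurableSet.standardBorel`, `Equiv.polishSpace_induced`,
`MeasurableEmbedding.equivRange`; no instance for `PointwiseConvergenceCLM` at the pin.
-/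

noncomputable section

namespace Literature.MathematicalPhysics.QuantumLattice

open _root_.MeasureTheory _root_.TopologicalSpace Set Filter _root_.Topology
open scoped SchwartzMap
open Literature.Analysis.FunctionSpaces

variable {E : Type*} [NormedAddCommGroup E] [NormedSpace ℝ E]

/-- **Borel = cylinder on `𝓢'(E)`** (`E` finite-dimensional): the Borel σ-algebra of the weak-* topology on
`FieldConfig E` is generated by the evaluations `ω ↦ ω f`, `f ∈ 𝓢(E, ℝ)` (the tree's
`borel_eq_dualCylinderSigma_of_separableSpace` with the separability of the Schwartz space). [folklore] -/
theorem measurableSpace_fieldConfig_eq_iSup [FiniteDimensional ℝ E] :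
    (FieldConfig.instMeasurableSpace : MeasurableSpace (FieldConfig E)) =
      ⨆ f : 𝓢(E, ℝ), (borel ℝ).comap fun ω : FieldConfig E => ω f := by
  haveI : SeparableSpace 𝓢(E, ℝ) := separableSpace_schwartzMap_holds E ℝ
  exact borel_eq_dualCylinderSigma_of_separableSpace 𝓢(E, ℝ)

/-- Measurability of a map into `FieldConfig E` (`E` finite-dimensional) is checked on the evaluations.
[folklore] -/
theorem measurable_fieldConfig_iff [FiniteDimensional ℝ E] {α : Type*} {mα : MeasurableSpace α}
    {g : α → FieldConfig E} : Measurable g ↔ ∀ f : 𝓢(E, ℝ), Measurable fun a => g a f := by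
  refine ⟨fun hg f => (measurable_eval f).comp hg, fun h => ?_⟩
  rw [measurable_iff_comap_le, measurableSpace_fieldConfig_eq_iSup, MeasurableSpace.comap_iSup]
  refine iSup_le fun f => ?_
  rw [MeasurableSpace.comap_comp]
  exact (h f).comap_le

/-- If `f` lies in the closure of the range of a sequence `u` of test functions, the evaluation at `f`
is measurable for the σ-algebra generated by the evaluations at the `u n` (it is a pointwise limit of
them along a subsequence, every configuration being continuous on `𝓢`). [folklore] -/
theorem comap_eval_le_evalSigma_of_mem_closure {u : ℕ → 𝓢(E, ℝ)} {f : 𝓢(E, ℝ)}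
    (hf : f ∈ closure (Set.range u)) :
    (borel ℝ).comap (fun ω : FieldConfig E => ω f) ≤ (⨆ i, (borel ℝ).comap fun ω : FieldConfig E => ω (u i)) := by
  obtain ⟨x, hx, hlim⟩ := mem_closure_iff_seq_limit.1 hf
  choose n hn using fun k => Set.mem_range.1 (hx k)
  have hmeas : ∀ k, Measurable[(⨆ i, (borel ℝ).comap fun ω : FieldConfig E => ω (u i))] fun ω : FieldConfig E => ω (u (n k)) := by
    intro k
    refine @Measurable.of_comap_le _ _ ((⨆ i, (borel ℝ).comap fun ω : FieldConfig E => ω (u i))) _ _ ?_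
    exact le_iSup (fun i => (borel ℝ).comap fun ω : FieldConfig E => ω (u i)) (n k)
  have hlim' : Tendsto (fun k => fun ω : FieldConfig E => ω (u (n k))) atTop
      (𝓝 fun ω : FieldConfig E => ω f) := by
    rw [tendsto_pi_nhds]
    intro ω
    have h1 : Tendsto (fun k => ω (x k)) atTop (𝓝 (ω f)) := (ω.continuous.tendsto f).comp hlim
    have h2 : (fun k => ω (x k)) = fun k => ω (u (n k)) := by
      funext k; rw [hn k]
    rwa [h2] at h1
  have := @measurable_of_tendsto_metrizable (FieldConfig E) ℝ ((⨆ i, (borel ℝ).comap fun ω : FieldConfig E => ω (u i))) _ _ _ _ _ _ hmeas hlim'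
  exact this.comap_le

/-- Evaluations at every member of a set `S` of test functions contained in the closure of the range of
a sequence `u` are measurable for the σ-algebra of the evaluations at the `u n`. [folklore] -/
theorem iSup_comap_eval_le_evalSigma {S : Set 𝓢(E, ℝ)} {u : ℕ → 𝓢(E, ℝ)}
    (hS : S ⊆ closure (Set.range u)) :
    (⨆ (f : 𝓢(E, ℝ)) (_ : f ∈ S), (borel ℝ).comap fun ω : FieldConfig E => ω f) ≤ (⨆ i, (borel ℝ).comap fun ω : FieldConfig E => ω (u i)) :=
  iSup₂_le fun _ hf => comap_eval_le_evalSigma_of_mem_closure (hS hf)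

/-! ### The evaluation embedding into `ℕ → ℝ` -/

/-- The evaluation map at a sequence of test functions is measurable. [folklore] -/
theorem measurable_evalSeq (u : ℕ → 𝓢(E, ℝ)) :
    Measurable (fun (ω : FieldConfig E) (n : ℕ) => ω (u n)) :=
  measurable_pi_lambda _ fun n => measurable_eval (u n)

/-- The evaluation map at a sequence of test functions is weak-* continuous. [folklore] -/
theorem continuous_evalSeq (u : ℕ → 𝓢(E, ℝ)) :
    Continuous (fun (ω : FieldConfig E) (n : ℕ) => ω (u n)) :=
  continuous_pi fun n => continuous_eval_const (u n)

/-- The evaluation map at a DENSE sequence is injective (configurations are continuous on `𝓢`).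
[folklore] -/
theorem injective_evalSeq {u : ℕ → 𝓢(E, ℝ)} (hu : DenseRange u) :
    Function.Injective ((fun (ω : FieldConfig E) (n : ℕ) => ω (u n))) := by
  intro ω ω' h
  have hext : (⇑ω : 𝓢(E, ℝ) → ℝ) = ⇑ω' :=
    hu.equalizer ω.continuous ω'.continuous (funext fun n => congr_fun h n)
  exact DFunLike.coe_injective hext

/-- `comap (fun (ω : FieldConfig E) (n : ℕ) => ω (u n)) (product σ-algebra) = (⨆ i, (borel ℝ).comap fun ω : FieldConfig E => ω (u i))`. [folklore] -/
theorem comap_evalSeq (u : ℕ → 𝓢(E, ℝ)) :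
    (MeasurableSpace.pi : MeasurableSpace (ℕ → ℝ)).comap ((fun (ω : FieldConfig E) (n : ℕ) => ω (u n))) = (⨆ i, (borel ℝ).comap fun ω : FieldConfig E => ω (u i)) := by
  simp only [MeasurableSpace.pi, MeasurableSpace.comap_iSup, MeasurableSpace.comap_comp]
  rfl

/-- For a dense sequence `u` (and `E` finite-dimensional), `comap (fun (ω : FieldConfig E) (n : ℕ) => ω (u n)) = Borel`. [folklore] -/
theorem comap_evalSeq_eq [FiniteDimensional ℝ E] {u : ℕ → 𝓢(E, ℝ)} (hu : DenseRange u) :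
    (MeasurableSpace.pi : MeasurableSpace (ℕ → ℝ)).comap ((fun (ω : FieldConfig E) (n : ℕ) => ω (u n))) =
      (FieldConfig.instMeasurableSpace : MeasurableSpace (FieldConfig E)) := by
  refine le_antisymm (measurable_evalSeq u).comap_le ?_
  rw [comap_evalSeq, measurableSpace_fieldConfig_eq_iSup]
  refine iSup_le fun f => comap_eval_le_evalSigma_of_mem_closure ?_
  rw [hu.closure_range]; exact Set.mem_univ f

/-! ### Weak-* compactness of polars -/

/-- Every configuration lies in some polar (a continuous linear functional on `𝓢` is bounded by finitely
many Schwartz seminorms, `Seminorm.bound_of_continuous`). [folklore] -/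
theorem exists_mem_polar (ω : FieldConfig E) : ∃ (s : Finset (ℕ × ℕ)) (C : ℕ), ω ∈ {ω : FieldConfig E |
    ∀ f : 𝓢(E, ℝ), |ω f| ≤ (C : ℝ) * (s.sup (schwartzSeminormFamily ℝ E ℝ)) f} := by
  let q : Seminorm ℝ 𝓢(E, ℝ) := (normSeminorm ℝ ℝ).comp (ω : 𝓢(E, ℝ) →L[ℝ] ℝ).toLinearMap
  have hq : Continuous q := continuous_norm.comp ω.continuous
  obtain ⟨s, C, -, hC⟩ := Seminorm.bound_of_continuous (schwartz_withSeminorms ℝ E ℝ) q hq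
  refine ⟨s, ⌈(C : ℝ)⌉₊, fun f => ?_⟩
  have h0 : q f ≤ (C • s.sup (schwartzSeminormFamily ℝ E ℝ)) f := Seminorm.le_def.1 hC f
  have h1 : |ω f| ≤ C * (s.sup (schwartzSeminormFamily ℝ E ℝ)) f := by
    have h0' : q f ≤ (C : ℝ) * (s.sup (schwartzSeminormFamily ℝ E ℝ)) f := by
      simpa [NNReal.smul_def, smul_eq_mul] using h0
    have hqf : q f = |ω f| := by
      simp only [q, Seminorm.comp_apply, coe_normSeminorm, Real.norm_eq_abs]
      rfl
    rw [← hqf]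
    exact h0'
  exact h1.trans (mul_le_mul_of_nonneg_right (Nat.le_ceil _) (apply_nonneg _ _))

/-- **The polars are weak-* compact** (Banach–Alaoglu–Bourbaki for `𝓢'`: under the embedding
`ω ↦ ⇑ω` into `𝓢 → ℝ` the polar is the closed set of additive homogeneous functions inside a product of
compact intervals). [folklore] -/
theorem isCompact_polar (s : Finset (ℕ × ℕ)) {C : ℝ} (hC : 0 ≤ C) : IsCompact {ω : FieldConfig E |
    ∀ f : 𝓢(E, ℝ), |ω f| ≤ C * (s.sup (schwartzSeminormFamily ℝ E ℝ)) f} := by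
  set q : 𝓢(E, ℝ) → ℝ := fun f => C * (s.sup (schwartzSeminormFamily ℝ E ℝ)) f with hq
  set K' : Set (𝓢(E, ℝ) → ℝ) :=
    {v | (∀ f g, v (f + g) = v f + v g) ∧ (∀ (a : ℝ) f, v (a • f) = a * v f) ∧ ∀ f, |v f| ≤ q f}
    with hK'
  have hK'c : IsCompact K' := by
    have hbox : IsCompact (Set.pi Set.univ fun f : 𝓢(E, ℝ) => Set.Icc (-q f) (q f)) :=
      isCompact_univ_pi fun f => isCompact_Icc
    have hc1 : IsClosed {v : 𝓢(E, ℝ) → ℝ | ∀ f g, v (f + g) = v f + v g} := by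
      simp only [Set.setOf_forall]
      exact isClosed_iInter fun f => isClosed_iInter fun g =>
        isClosed_eq (continuous_apply _)
          (show Continuous fun v : 𝓢(E, ℝ) → ℝ => v f + v g by fun_prop)
    have hc2 : IsClosed {v : 𝓢(E, ℝ) → ℝ | ∀ (a : ℝ) f, v (a • f) = a * v f} := by
      simp only [Set.setOf_forall]
      exact isClosed_iInter fun a => isClosed_iInter fun f =>
        isClosed_eq (continuous_apply _)
          (show Continuous fun v : 𝓢(E, ℝ) → ℝ => a * v f by fun_prop)
    have hc3 : IsClosed {v : 𝓢(E, ℝ) → ℝ | ∀ f, |v f| ≤ q f} := by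
      simp only [Set.setOf_forall]
      exact isClosed_iInter fun f => isClosed_le (continuous_apply f).abs continuous_const
    refine hbox.of_isClosed_subset (hc1.inter (hc2.inter hc3)) ?_
    intro v hv
    simp only [Set.mem_pi, Set.mem_univ, Set.mem_Icc, forall_true_left]
    exact fun f => abs_le.1 (hv.2.2 f)
  have himage : ((⇑) : FieldConfig E → (𝓢(E, ℝ) → ℝ)) ''
      {ω : FieldConfig E | ∀ f : 𝓢(E, ℝ), |ω f| ≤ C * (s.sup (schwartzSeminormFamily ℝ E ℝ)) f} = K' := by
    apply Set.Subset.antisymm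
    · rintro _ ⟨ω, hω, rfl⟩
      exact ⟨fun f g => map_add ω f g, fun a f => by simp [map_smul], hω⟩
    · rintro v ⟨hadd, hsmul, hbd⟩
      let T : 𝓢(E, ℝ) →L[ℝ] ℝ :=
        SchwartzMap.mkCLMtoNormedSpace v hadd hsmul ⟨s, C, hC, fun f => by
          simpa [Real.norm_eq_abs] using hbd f⟩
      refine ⟨ContinuousLinearMap.toPointwiseConvergenceCLM _ _ _ _ T, fun f => hbd f, rfl⟩
  rw [(PointwiseConvergenceCLM.isEmbedding_coeFn (RingHom.id ℝ) 𝓢(E, ℝ) ℝ).isInducing.isCompact_iff,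
    himage]
  exact hK'c

/-- The range of the evaluation map at a sequence is a Borel subset of `ℕ → ℝ`: it is the countable
union of the compact images of the polars. [folklore] -/
theorem measurableSet_range_evalSeq (u : ℕ → 𝓢(E, ℝ)) :
    MeasurableSet (Set.range (fun (ω : FieldConfig E) (n : ℕ) => ω (u n))) := by
  set e : FieldConfig E → ℕ → ℝ := fun ω n => ω (u n) with he
  have hcov : Set.range e = ⋃ (p : Finset (ℕ × ℕ) × ℕ), e '' {ω : FieldConfig E |
      ∀ f : 𝓢(E, ℝ), |ω f| ≤ (p.2 : ℝ) * (p.1.sup (schwartzSeminormFamily ℝ E ℝ)) f} := by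
    apply Set.Subset.antisymm
    · rintro _ ⟨ω, rfl⟩
      obtain ⟨s, C, hω⟩ := exists_mem_polar ω
      exact Set.mem_iUnion.2 ⟨(s, C), ω, hω, rfl⟩
    · exact Set.iUnion_subset fun p => Set.image_subset_range _ _
  rw [hcov]
  refine MeasurableSet.iUnion fun p => ?_
  exact ((isCompact_polar p.1 (Nat.cast_nonneg _)).image
    (continuous_evalSeq u)).isClosed.measurableSet

/-- For a dense sequence `u` (`E` finite-dimensional) the evaluation map is a measurable embedding of
`FieldConfig E` into `ℕ → ℝ`. [folklore] -/
theorem measurableEmbedding_evalSeq [FiniteDimensional ℝ E] {u : ℕ → 𝓢(E, ℝ)} (hu : DenseRange u) :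
    MeasurableEmbedding (fun (ω : FieldConfig E) (n : ℕ) => ω (u n)) where
  injective := injective_evalSeq hu
  measurable := measurable_evalSeq u
  measurableSet_image' := by
    intro t ht
    have ht' : MeasurableSet[(MeasurableSpace.pi : MeasurableSpace (ℕ → ℝ)).comap
        (fun (ω : FieldConfig E) (n : ℕ) => ω (u n))] t := by
      rw [comap_evalSeq_eq hu]; exact ht
    obtain ⟨t', ht'm, rfl⟩ := ht'
    rw [Set.image_preimage_eq_inter_range]
    exact ht'm.inter (measurableSet_range_evalSeq u)

/-- **`FieldConfig E = 𝓢'(E)` is a standard Borel space** for finite-dimensional `E` (Lusin: the weak-*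
dual of the separable Fréchet space `𝓢(E)` with its Borel σ-algebra is Borel-isomorphic to a Borel subset
of `ℕ → ℝ`). A theorem, not an instance; use `haveI`. [folklore] -/
theorem standardBorelSpace_fieldConfig [FiniteDimensional ℝ E] : StandardBorelSpace (FieldConfig E) := by
  haveI : SeparableSpace 𝓢(E, ℝ) := separableSpace_schwartzMap_holds E ℝ
  obtain ⟨u, hu⟩ := TopologicalSpace.exists_dense_seq 𝓢(E, ℝ)
  have he := measurableEmbedding_evalSeq (E := E) hu
  set R : Set (ℕ → ℝ) := Set.range (fun (ω : FieldConfig E) (n : ℕ) => ω (u n)) with hR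
  haveI : StandardBorelSpace R := (measurableSet_range_evalSeq u).standardBorel
  let eqv : FieldConfig E ≃ᵐ R := he.equivRange
  let Up := upgradeStandardBorel R
  let tR : TopologicalSpace R := Up.toTopologicalSpace
  have hPR : @PolishSpace R tR := Up.toPolishSpace
  let tΩ : TopologicalSpace (FieldConfig E) := tR.induced eqv
  have hpol : @PolishSpace (FieldConfig E) tΩ :=
    @Equiv.polishSpace_induced (FieldConfig E) _ tR hPR eqv.toEquiv
  have hbor : @BorelSpace (FieldConfig E) tΩ FieldConfig.instMeasurableSpace := by
    refine @BorelSpace.mk (FieldConfig E) tΩ _ ?_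
    rw [@borel_comap (FieldConfig E) _ eqv tR]
    have h1 : @borel _ tR = (inferInstance : MeasurableSpace R) :=
      (eq_borel_upgradeStandardBorel R).symm
    rw [h1]
    exact eqv.measurableEmbedding.comap_eq.symm
  exact ⟨⟨tΩ, hbor, hpol⟩⟩

end Literature.MathematicalPhysics.QuantumLattice

end
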